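import Summits.AtomisticToContinuum.FouriersLaw.Theorems.VanishingNoiseTransferNoiseLocalityStubResponseDensityNoisyDyson7

/-!
# Flip-noisy response density, step 9: continuity of the response series in the temperature
difference (helpers for stub `stub_responseDensityNoisy`)

Helper file `--supports stmt-AtomisticToContinuum-11975` (crux `NoiseLocality`, route
`VanishingNoiseTransfer`, line `relative-flip-energy-transfer`, stub 1b `stub_responseDensityNoisy`),
namespace `…NoiseLocality.StubResponseDensityNoisy.Dyson`.

The response series `S_δ(φ) = ∑ₙ π_T(g · Kⁿ_δ R_δ φ)` of `…Dyson8` (`g = p_0² - p_{N-1}²`, kernels with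
baths at `T ± δ/2`) is a CONTINUOUS function of `δ`: here for the CLAMPED temperature difference
`δ̂ = max(-T, min(T, δ))` (so that the kernels are defined for every real `δ`, and agree with the
true ones for `|δ| ≤ T`): `continuous_responseSeries`. Termwise continuity is the weighted joint
Feller property of `…Dyson3` and dominated convergence against `π_T`; the uniform geometric tail
`|aₙ(δ)| ≤ B ᾱⁿ` comes from the uniform Harris bounds (`…Dyson7`, with the invariant laws of the
embedded chains of `VelocityFlipEmbeddedChainSteadyState.lean`, `N ≥ 2`), so the series converges
locally uniformly. Also: the kernels only depend on the temperatures (`resolventKernel_congr`,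
`embeddedFlipKernel_congr`).

No definitions.
-/

noncomputable section

open MeasureTheory ProbabilityTheory Filter Topology Set
open scoped NNReal ENNReal

namespace Summit.AtomisticToContinuum.FouriersLaw.Theorems.NoiseLocality.StubResponseDensityNoisy.Dyson

open Literature.MathematicalPhysics.KineticTheory.HeatConduction
open Literature.Probability.Process Literature.MathematicalPhysics.KineticTheory OscillatorChain

variable {N : ℕ}

/-! ### The kernels depend on the temperatures only -/

section Congr

variable {ω₂ lam β γ : ℝ} (hω : 0 < ω₂) (hl : 0 ≤ lam) (hβ : 0 ≤ β) (hγ : 0 ≤ γ) (hN : 0 < N)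

/-- The resolvent kernel of `pinnedChainSemigroup` depends on the bath temperatures only (not on the
positivity witnesses). -/
theorem resolventKernel_congr {T_L T_R T_L' T_R' : ℝ} (hL : 0 ≤ T_L) (hR : 0 ≤ T_R) (hL' : 0 ≤ T_L')
    (hR' : 0 ≤ T_R') (eL : T_L = T_L') (eR : T_R = T_R') (r : ℝ) :
    (pinnedChainSemigroup hω hl hβ hγ hN hL hR).resolventKernel r =
      (pinnedChainSemigroup hω hl hβ hγ hN hL' hR').resolventKernel r := by
  subst eL eR; rfl

/-- The embedded flip kernel of `pinnedChainSemigroup` depends on the bath temperatures only. -/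
theorem embeddedFlipKernel_congr {T_L T_R T_L' T_R' : ℝ} (hL : 0 ≤ T_L) (hR : 0 ≤ T_R) (hL' : 0 ≤ T_L')
    (hR' : 0 ≤ T_R') (eL : T_L = T_L') (eR : T_R = T_R') (r : ℝ) :
    (pinnedChainSemigroup hω hl hβ hγ hN hL hR).embeddedFlipKernel r =
      (pinnedChainSemigroup hω hl hβ hγ hN hL' hR').embeddedFlipKernel r := by
  subst eL eR; rfl

end Congr

/-! ### The clamped temperature difference -/

/-- `δ̂ = max(-T, min(T, δ)) = δ` for `|δ| ≤ T`. -/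
theorem clamp_eq {T δ : ℝ} (h : |δ| ≤ T) : max (-T) (min T δ) = δ := by
  have h1 := abs_le.1 h
  rw [min_eq_right h1.2, max_eq_right h1.1]

/-- The clamp is continuous. -/
theorem continuous_clamp (T : ℝ) : Continuous fun δ : ℝ => max (-T) (min T δ) :=
  continuous_const.max (continuous_const.min continuous_id)

/-- Baths at `T ± δ̂/2` lie in the window `(0, 2T]`, for every real `δ`. -/
theorem clamp_window {T : ℝ} (hT : 0 < T) (δ : ℝ) :
    0 < T + max (-T) (min T δ) / 2 ∧ T + max (-T) (min T δ) / 2 ≤ 2 * T ∧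
      0 < T - max (-T) (min T δ) / 2 ∧ T - max (-T) (min T δ) / 2 ≤ 2 * T := by
  have h1 : -T ≤ max (-T) (min T δ) := le_max_left _ _
  have h2 : max (-T) (min T δ) ≤ T := max_le (by linarith) (min_le_left _ _)
  refine ⟨by linarith, by linarith, by linarith, by linarith⟩

/-- Baths at `T ± δ̂/2` lie in `[T/2, 2T]`, for every real `δ`. -/
theorem clamp_window' {T : ℝ} (hT : 0 < T) (δ : ℝ) :
    T / 2 ≤ T + max (-T) (min T δ) / 2 ∧ T / 2 ≤ T - max (-T) (min T δ) / 2 := by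
  have h1 : -T ≤ max (-T) (min T δ) := le_max_left _ _
  have h2 : max (-T) (min T δ) ≤ T := max_le (by linarith) (min_le_left _ _)
  exact ⟨by linarith, by linarith⟩

section Limit

variable {ω₂ lam β γ : ℝ} (hω : 0 < ω₂) (hl : 0 < lam) (hβ : 0 < β) (hγ : 0 < γ) (hN2 : 1 < N)
  {T : ℝ} (hT : 0 < T) {ϑ : ℝ} (hϑ : 0 < ϑ) (h2ϑT : 2 * ϑ < 1 / (2 * T)) {r : ℝ} (hr : 0 < r)
include hω hl hβ hγ hN2 hT hϑ h2ϑT hr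

set_option maxHeartbeats 800000 in
/-- **The response series is continuous in the (clamped) temperature difference.** For `N ≥ 2` and
continuous `φ` with `|φ| ≤ C e^{ϑH}` (`C ≥ 0`), the function
`δ ↦ ∑ₙ π_T(g · Kⁿ R φ)` — kernels with baths at `T ± δ̂/2`, `δ̂ = max(-T, min(T, δ))`,
`g = p_0² - p_{N-1}²` — is continuous on `ℝ`, and its terms satisfy `|aₙ(δ)| ≤ B ᾱⁿ` for all `δ`. -/
theorem continuous_responseSeries {φ : PhaseSpace N → ℝ} (hφ : Continuous φ) {C : ℝ} (hC : 0 ≤ C)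
    (hφb : ∀ y, |φ y| ≤ C * Real.exp (ϑ * (pinnedChain ω₂ lam β γ).hamiltonian N y)) :
    Continuous fun δ : ℝ => ∑' n : ℕ, ∫ x, (x.2 ⟨0, Nat.zero_lt_of_lt hN2⟩ ^ 2 - x.2 ⟨N - 1, by omega⟩ ^ 2) *
      (∫ y, (∫ z, φ z ∂((pinnedChainSemigroup hω hl.le hβ.le hγ.le (Nat.zero_lt_of_lt hN2)
          (clamp_window hT δ).1.le (clamp_window hT δ).2.2.1.le).resolventKernel r y))
        ∂((((pinnedChainSemigroup hω hl.le hβ.le hγ.le (Nat.zero_lt_of_lt hN2)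
          (clamp_window hT δ).1.le (clamp_window hT δ).2.2.1.le).embeddedFlipKernel r) ^ n) x))
      ∂((pinnedChain ω₂ lam β γ).gibbsMeasure N T) := by
  have hN : 0 < N := Nat.zero_lt_of_lt hN2
  set Pc := pinnedChain ω₂ lam β γ with hPc
  have hHc : Continuous (Pc.hamiltonian N) := pinnedChain_continuous_hamiltonian ω₂ lam β γ N
  have hϑT : ϑ < 1 / (2 * T) := theta_lt_of_two_theta_lt hϑ h2ϑT
  haveI := pinnedChain_isProbabilityMeasure_gibbsMeasure hω hl.le hβ.le γ N hT
  -- the clamped temperatures as functions of `δ`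
  set τL : ℝ → ℝ := fun δ => T + max (-T) (min T δ) / 2 with hτL
  set τR : ℝ → ℝ := fun δ => T - max (-T) (min T δ) / 2 with hτR
  have hτLc : Continuous τL := continuous_const.add ((continuous_clamp T).div_const _)
  have hτRc : Continuous τR := continuous_const.sub ((continuous_clamp T).div_const _)
  have hwin : ∀ δ, 0 < τL δ ∧ τL δ ≤ 2 * T ∧ 0 < τR δ ∧ τR δ ≤ 2 * T := fun δ => clamp_window hT δ
  -- kernels
  set Rf : ℝ → Kernel (PhaseSpace N) (PhaseSpace N) := fun δ => (pinnedChainSemigroup hω hl.le hβ.le hγ.le hN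
    (clamp_window hT δ).1.le (clamp_window hT δ).2.2.1.le).resolventKernel r with hRf
  set Kf : ℝ → Kernel (PhaseSpace N) (PhaseSpace N) := fun δ => (pinnedChainSemigroup hω hl.le hβ.le hγ.le hN
    (clamp_window hT δ).1.le (clamp_window hT δ).2.2.1.le).embeddedFlipKernel r with hKf
  haveI hMR : ∀ δ, IsMarkovKernel (Rf δ) := fun δ =>
    (pinnedChainSemigroup hω hl.le hβ.le hγ.le hN (clamp_window hT δ).1.le (clamp_window hT δ).2.2.1.le).isMarkovKernel_resolventKernel hr
  haveI hMK : ∀ δ, IsMarkovKernel (Kf δ) := fun δ =>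
    (pinnedChainSemigroup hω hl.le hβ.le hγ.le hN (clamp_window hT δ).1.le (clamp_window hT δ).2.2.1.le).isMarkovKernel_embeddedFlipKernel hr
  haveI : ∀ (δ : ℝ) (n : ℕ), IsMarkovKernel ((Kf δ) ^ n) := fun δ n => Harris.isMarkovKernel_pow _ n
  show Continuous fun δ : ℝ => ∑' n : ℕ, ∫ x, (x.2 ⟨0, hN⟩ ^ 2 - x.2 ⟨N - 1, by omega⟩ ^ 2) *
      (∫ y, (∫ z, φ z ∂(Rf δ y)) ∂(((Kf δ) ^ n) x)) ∂(Pc.gibbsMeasure N T)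
  -- uniform constants
  obtain ⟨abar, Cπ, Cg, h0, h1, hCπ, hCg, hP⟩ := poisson_embeddedFlipKernel hω hl hβ hγ hN hT hϑ h2ϑT hr
  obtain ⟨_c, _B, a, b, _hc, _hB, ha, hb, hunif⟩ := lintegral_exp_kernel_resolventKernel_le_unif hω hl hβ hγ hN hT hϑ hϑT hr
  obtain ⟨Cp, hCp, hpowℝ⟩ := continuous_integral_embeddedFlipKernel_pow_param hω hl hβ hγ hN hT hϑ h2ϑT
    (Y := ℝ) hτLc hτRc hwin hr
  obtain ⟨hIg, hgf⟩ := integrable_gibbs_oddMoment_mul hω hl hβ hN hT h2ϑT (γ := γ) (ϑ := ϑ)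
  set Ig : ℝ := ∫ x, (1 + x.2 ⟨0, hN⟩ ^ 2 + x.2 ⟨N - 1, by omega⟩ ^ 2) * Real.exp (ϑ * Pc.hamiltonian N x)
    ∂(Pc.gibbsMeasure N T) with hIgdef
  have hIg0 : 0 ≤ Ig := integral_nonneg fun x => by positivity
  set CR : ℝ := a.toReal + b.toReal with hCR
  have hCR0 : 0 ≤ CR := by positivity
  have hWm : Measurable fun z => Real.exp (ϑ * Pc.hamiltonian N z) :=
    (Real.continuous_exp.comp (continuous_const.mul hHc)).measurable
  have hW1 : ∀ x, (1 : ℝ) ≤ Real.exp (ϑ * Pc.hamiltonian N x) := fun x =>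
    Real.one_le_exp (mul_nonneg hϑ.le (pinnedChain_hamiltonian_nonneg hω.le hl.le hβ.le γ N x))
  -- `g` and `π_T(g) = 0`
  set g : PhaseSpace N → ℝ := fun x => x.2 ⟨0, hN⟩ ^ 2 - x.2 ⟨N - 1, by omega⟩ ^ 2 with hg
  have hgc : Continuous g := by rw [hg]; fun_prop
  have hgabs : ∀ x : PhaseSpace N, |g x| ≤ 1 + x.2 ⟨0, hN⟩ ^ 2 + x.2 ⟨N - 1, by omega⟩ ^ 2 := fun x => by
    rw [hg]; dsimp only
    rw [abs_le]; constructor <;> nlinarith [sq_nonneg (x.2 ⟨0, hN⟩), sq_nonneg (x.2 ⟨N - 1, by omega⟩)]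
  have hgI : Integrable g (Pc.gibbsMeasure N T) := hIg.mono' hgc.aestronglyMeasurable (Eventually.of_forall fun y => by
    rw [Real.norm_eq_abs]
    refine (hgabs y).trans ?_
    have h1 := hW1 y
    have h0 : 0 ≤ 1 + y.2 ⟨0, hN⟩ ^ 2 + y.2 ⟨N - 1, by omega⟩ ^ 2 := by positivity
    nlinarith)
  have hg0 : ∫ x, g x ∂(Pc.gibbsMeasure N T) = 0 := integral_gibbs_oddMoment hω hl hβ hγ hN hT
  have hgf' : ∀ {f : PhaseSpace N → ℝ}, Continuous f → ∀ {Cf : ℝ}, 0 ≤ Cf →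
      (∀ y, |f y| ≤ Cf * Real.exp (ϑ * Pc.hamiltonian N y)) →
      Integrable (fun x => g x * f x) (Pc.gibbsMeasure N T) ∧ |∫ x, g x * f x ∂(Pc.gibbsMeasure N T)| ≤ Cf * Ig :=
    fun hf _ hCf hfb => hgf hf hCf hfb
  -- `ψ(δ, y) = R_δ φ (y)`: joint continuity and the uniform bound
  have hψjc : Continuous fun p : ℝ × PhaseSpace N => ∫ z, φ z ∂(Rf p.1 p.2) :=
    (continuous_integral_resolventKernel_param hω hl hβ hγ hN hT hϑ h2ϑT (Y := ℝ) hτLc hτRc hwin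
      (F := fun _ => φ) (hφ.comp continuous_snd) hC (fun _ y => hφb y) hr).2
  have hψδc : ∀ δ : ℝ, Continuous fun y => ∫ z, φ z ∂(Rf δ y) := fun δ =>
    (show Continuous (Function.uncurry fun (δ : ℝ) (y : PhaseSpace N) => ∫ z, φ z ∂(Rf δ y)) from hψjc).uncurry_left δ
  have hψb : ∀ (δ : ℝ) (y : PhaseSpace N), |∫ z, φ z ∂(Rf δ y)| ≤ C * CR * Real.exp (ϑ * Pc.hamiltonian N y) := by
    intro δ y
    have hRes := (hunif (τL δ) (τR δ) (hwin δ).1 (hwin δ).2.1 (hwin δ).2.2.1 (hwin δ).2.2.2).2 y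
    have h := (integrable_abs_integral_le_of_lintegral_le hWm (fun z => (Real.exp_pos _).le)
      (ENNReal.add_ne_top.2 ⟨ENNReal.mul_ne_top ha.ne_top ENNReal.ofReal_ne_top, hb⟩) hRes
      hφ.aestronglyMeasurable hC hφb).2
    rw [toReal_affine ha.ne_top hb (Real.exp_pos _).le] at h
    refine h.trans ?_
    have := ENNReal.toReal_nonneg (a := a); have := ENNReal.toReal_nonneg (a := b)
    nlinarith [hW1 y, mul_nonneg hC (ENNReal.toReal_nonneg (a := b))]
  have hM : 0 ≤ C * CR := by positivity
  -- `W_n(δ, x) = Kⁿ_δ ψ_δ (x)`: joint continuity and the weighted bound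
  have hW : ∀ n : ℕ, (∀ (δ : ℝ) (x : PhaseSpace N), |∫ y, (∫ z, φ z ∂(Rf δ y)) ∂(((Kf δ) ^ n) x)| ≤
      C * CR * (Real.exp (ϑ * Pc.hamiltonian N x) + Cp)) ∧
      Continuous fun p : ℝ × PhaseSpace N => ∫ y, (∫ z, φ z ∂(Rf p.1 y)) ∂(((Kf p.1) ^ n) p.2) := by
    intro n
    obtain ⟨hIB, hc⟩ := hpowℝ (F := fun δ y => ∫ z, φ z ∂(Rf δ y)) hψjc hM hψb n
    exact ⟨fun δ x => (hIB δ x).2, hc⟩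
  have hWδc : ∀ (n : ℕ) (δ : ℝ), Continuous fun x => ∫ y, (∫ z, φ z ∂(Rf δ y)) ∂(((Kf δ) ^ n) x) := fun n δ =>
    (show Continuous (Function.uncurry fun (δ : ℝ) (x : PhaseSpace N) => ∫ y, (∫ z, φ z ∂(Rf δ y)) ∂(((Kf δ) ^ n) x))
      from (hW n).2).uncurry_left δ
  have hWxc : ∀ (n : ℕ) (x : PhaseSpace N), Continuous fun δ : ℝ => ∫ y, (∫ z, φ z ∂(Rf δ y)) ∂(((Kf δ) ^ n) x) := fun n x =>
    (show Continuous (Function.uncurry fun (δ : ℝ) (x : PhaseSpace N) => ∫ y, (∫ z, φ z ∂(Rf δ y)) ∂(((Kf δ) ^ n) x))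
      from (hW n).2).uncurry_right x
  -- the terms `aₙ(δ) = π_T(g · W_n(δ, ·))` are continuous in `δ`
  have hterm : ∀ n : ℕ, Continuous fun δ : ℝ => ∫ x, g x * (∫ y, (∫ z, φ z ∂(Rf δ y)) ∂(((Kf δ) ^ n) x))
      ∂(Pc.gibbsMeasure N T) := by
    intro n
    obtain ⟨hWb, -⟩ := hW n
    refine continuous_of_dominated (bound := fun x => C * CR * (1 + Cp) *
      ((1 + x.2 ⟨0, hN⟩ ^ 2 + x.2 ⟨N - 1, by omega⟩ ^ 2) * Real.exp (ϑ * Pc.hamiltonian N x)))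
      (fun δ => ?_) (fun δ => Eventually.of_forall fun x => ?_) (hIg.const_mul _) (Eventually.of_forall fun x => ?_)
    · exact (hgc.mul (hWδc n δ)).aestronglyMeasurable
    · rw [Real.norm_eq_abs, abs_mul]
      have hq : (0 : ℝ) ≤ 1 + x.2 ⟨0, hN⟩ ^ 2 + x.2 ⟨N - 1, by omega⟩ ^ 2 := by positivity
      have he := hW1 x
      calc |g x| * |∫ y, (∫ z, φ z ∂(Rf δ y)) ∂(((Kf δ) ^ n) x)|
          ≤ (1 + x.2 ⟨0, hN⟩ ^ 2 + x.2 ⟨N - 1, by omega⟩ ^ 2) * (C * CR * (Real.exp (ϑ * Pc.hamiltonian N x) + Cp)) :=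
            mul_le_mul (hgabs x) (hWb δ x) (abs_nonneg _) hq
        _ ≤ (1 + x.2 ⟨0, hN⟩ ^ 2 + x.2 ⟨N - 1, by omega⟩ ^ 2) * (C * CR * ((1 + Cp) * Real.exp (ϑ * Pc.hamiltonian N x))) := by
            refine mul_le_mul_of_nonneg_left (mul_le_mul_of_nonneg_left ?_ hM) hq
            nlinarith
        _ = _ := by ring
    · exact continuous_const.mul (hWxc n x)
  -- the uniform geometric bound `|aₙ(δ)| ≤ B ᾱⁿ`
  have hbound : ∀ (n : ℕ) (δ : ℝ), ‖∫ x, g x * (∫ y, (∫ z, φ z ∂(Rf δ y)) ∂(((Kf δ) ^ n) x)) ∂(Pc.gibbsMeasure N T)‖ ≤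
      Cg * (C * CR) * Ig * abar ^ n := by
    intro n δ
    rw [Real.norm_eq_abs]
    -- an invariant law of `K_δ` (Krylov–Bogoliubov, tree)
    have hmaxT : ϑ < 1 / max (τL δ) (τR δ) := theta_lt_inv_max hϑT (hwin δ).1 (hwin δ).2.1 (hwin δ).2.2.2
    obtain ⟨π, hπ, hinv, -⟩ := pinnedChain_exists_invariant_embeddedFlipKernel hω hl hβ hγ hN2 (hwin δ).1 (hwin δ).2.2.1
      hr hϑ hmaxT
    haveI := hπ
    have hinv' : Kernel.Invariant (Kf δ) π := hinv
    obtain ⟨-, hPψ⟩ := hP (τL δ) (τR δ) (clamp_window' hT δ).1 (hwin δ).2.1 (clamp_window' hT δ).2 (hwin δ).2.2.2 π hπ hinv'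
    obtain ⟨hgeo0, -, -, -, -⟩ := hPψ (fun y => ∫ z, φ z ∂(Rf δ y)) (hψδc δ) (C * CR) hM (hψb δ)
    have hgeo : ∀ (m : ℕ) (x : PhaseSpace N), |(∫ y, (∫ z, φ z ∂(Rf δ y)) ∂(((Kf δ) ^ m) x)) -
        ∫ y, (∫ z, φ z ∂(Rf δ y)) ∂π| ≤ Cg * abar ^ m * (C * CR) * Real.exp (ϑ * Pc.hamiltonian N x) := hgeo0
    have hcen : Continuous fun x => (∫ y, (∫ z, φ z ∂(Rf δ y)) ∂(((Kf δ) ^ n) x)) - ∫ y, (∫ z, φ z ∂(Rf δ y)) ∂π :=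
      (hWδc n δ).sub continuous_const
    obtain ⟨hfI, hfb⟩ := hgf' hcen (mul_nonneg (mul_nonneg hCg (pow_nonneg h0.le n)) hM) (fun x => hgeo n x)
    have hsplit : ∫ x, g x * (∫ y, (∫ z, φ z ∂(Rf δ y)) ∂(((Kf δ) ^ n) x)) ∂(Pc.gibbsMeasure N T) =
        ∫ x, g x * ((∫ y, (∫ z, φ z ∂(Rf δ y)) ∂(((Kf δ) ^ n) x)) - ∫ y, (∫ z, φ z ∂(Rf δ y)) ∂π) ∂(Pc.gibbsMeasure N T) := by
      have e : ∀ x : PhaseSpace N, g x * (∫ y, (∫ z, φ z ∂(Rf δ y)) ∂(((Kf δ) ^ n) x)) =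
          g x * ((∫ y, (∫ z, φ z ∂(Rf δ y)) ∂(((Kf δ) ^ n) x)) - ∫ y, (∫ z, φ z ∂(Rf δ y)) ∂π) +
            (∫ y, (∫ z, φ z ∂(Rf δ y)) ∂π) * g x := fun x => by ring
      simp_rw [e]
      rw [integral_add hfI (hgI.const_mul _), integral_const_mul, hg0, mul_zero, add_zero]
    rw [hsplit]
    refine hfb.trans (le_of_eq (by ring))
  exact continuous_tsum hterm (((summable_geometric_of_lt_one h0.le h1).mul_left (Cg * (C * CR) * Ig))) hbound

end Limit

/-- Registered helper sub-goal `helper_responseDensityNoisyDysonSeriesContinuous` of stmt-AtomisticToContinuum-11975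
(fully quantified, notation-free one-line form of the main theorem of this file). -/
theorem helper_responseDensityNoisyDysonSeriesContinuous : ∀ (ω₂ lam β γ : ℝ) (hω : 0 < ω₂) (hl : 0 < lam) (hβ : 0 < β) (hγ : 0 < γ) (N : ℕ) (hN2 : 1 < N) (T : ℝ) (hT : 0 < T) (ϑ : ℝ) (hϑ : 0 < ϑ) (h2ϑT : 2 * ϑ < 1 / (2 * T)) (r : ℝ) (hr : 0 < r) (φ : Literature.MathematicalPhysics.KineticTheory.HeatConduction.PhaseSpace N → ℝ) (hφ : Continuous φ) (C : ℝ) (hC : 0 ≤ C) (hφb : ∀ y, |φ y| ≤ C * Real.exp (ϑ * (Literature.MathematicalPhysics.KineticTheory.HeatConduction.pinnedChain ω₂ lam β γ).hamiltonian N y)), Continuous fun δ : ℝ => ∑' n : ℕ, ∫ x, (x.2 ⟨0, Nat.zero_lt_of_lt hN2⟩ ^ 2 - x.2 ⟨N - 1, by omega⟩ ^ 2) * (∫ y, (∫ z, φ z ∂((Literature.MathematicalPhysics.KineticTheory.HeatConduction.pinnedChainSemigroup hω hl.le hβ.le hγ.le (Nat.zero_lt_of_lt hN2) (Summit.AtomisticToContinuum.FouriersLaw.Theorems.NoiseLocality.StubResponseDensityNoisy.Dyson.clamp_window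 hT δ).1.le (Summit.AtomisticToContinuum.FouriersLaw.Theorems.NoiseLocality.StubResponseDensityNoisy.Dyson.clamp_window hT δ).2.2.1.le).resolventKernel r y)) ∂((((Literature.MathematicalPhysics.KineticTheory.HeatConduction.pinnedChainSemigroup hω hl.le hβ.le hγ.le (Nat.zero_lt_of_lt hN2) (Summit.AtomisticToContinuum.FouriersLaw.Theorems.NoiseLocality.StubResponseDensityNoisy.Dyson.clamp_window hT δ).1.le (Summit.AtomisticToContinuum.FouriersLaw.Theorems.NoiseLocality.StubResponseDensityNoisy.Dyson.clamp_window hT δ).2.2.1.le).embeddedFlipKernel r) ^ n) x)) ∂((Literature.MathematicalPhysics.KineticTheory.HeatConduction.pinnedChain ω₂ lam β γ).gibbsMeasure N T) :=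
  fun _ _ _ _ hω hl hβ hγ _ hN2 _ hT _ hϑ h2ϑT _ hr _ hφ _ hC hφb => continuous_responseSeries hω hl hβ hγ hN2 hT hϑ h2ϑT hr hφ hC hφb

end Summit.AtomisticToContinuum.FouriersLaw.Theorems.NoiseLocality.StubResponseDensityNoisy.Dyson

end
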